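/-
Copyright (c) 2026 the pub-hodgecm-mathlib formalisation cell (harness21).  Prover seat hodgecm-mathlib-K2Liu-p26 (g4) on loan to SLAB R90-TF, section S1 «Ch. 10∕12 local»
(dealer R90-C10-plan (g4), R-S1-53): (W-2e) TOOL FILE «THE THREE INNER ADDITIVE VALUES» — the values `ν(C)`, `−ν(B⁺_2)`, `0` of `∫_C ψ dν` for an additive character `ψ` of
the fixed integers according to its conductor (`≤ 0`, `∈ (0, 2]`, `> 2`), over ★ (W-9) `R90S1WildAdditiveBallOrthogonality`; consumer = P-WILD-1 (R90-C10-p08 (g3): the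
letters `hI₀ hI₁ hI₂` of ★ p865411 `gauss_sq_eq_wild`); crux H413 = `stmt-HodgeConjecture-24833`.  KERNEL module: THEOREMS ONLY (no definition, no named fact, no `sorry`,
no instance, no notation).  2026-09-05.
-/
import Summits.HodgeConjecture.HodgeConjecture.Theorems.R90S1WildAdditiveBallOrthogonality   -- ★ p865400 (W-9, this seat): `measurableSet_ball`, `mem_ball_add_iff`, `varpi_pow_le_one`; brings ★ (W-2c) and the ★ `R⁺`-Haar frame (`measurableSet_fixedUnits`)
import HarnessLib

/-!
# R90 · S1 ∕ U4Keys wild leaf — (W-2e) TOOL FILE: THE THREE INNER ADDITIVE VALUES `∫_C ψ dν ∈ {ν(C), −ν(B⁺_2), 0}` ON THE FIXED UNITS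
# (`Theorems/R90S1WildInnerAdditiveSums.lean`; ns `Summit.HodgeConjecture.HodgeConjecture.R90.S1.WildInnerAdditiveSums`)

FRAME (= ★ (W-9) ∕ ★ `R90S1BposRamFixedUnitsHaar` VERBATIM): `R = LocalRing L v`, `R⁺ = ↥(HeisRing.fixedPart (conjLocal L c̄ v))`, `w : PlacesOver L v`, uniformiser letter
`hϖ : Valued.v ϖ = WithZero.exp (-1 : ℤ)`; the fixed integers `𝒪⁺ := {c : |c_w| ≤ 1}`, the balls `B⁺_j := {c : |c_w| ≤ |ϖ|^j}` (★ (W-9), inline), the fixed units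
`C := {c : |c_w| = 1}` (★ `measurableSet_fixedUnits`) — all spelled INLINE exactly as in the consumer ★ p865411's letters `hI₀ hI₁ hI₂`; a measure `ν` on `R⁺`, LEFT-INVARIANT under
addition only.  The function `ψ : R⁺ → ℂ` is an ADDITIVE CHARACTER ON `𝒪⁺` in the weakest form the consumer can supply: `hψadd : ∀ a b, |a_w| ≤ 1 → |b_w| ≤ 1 → ψ (a + b) = ψ a · ψ b`
(P-WILD-1's `c ↦ Ē(1 + u(1+e)c)` is additive on `𝒪⁺`, not on `R⁺`).  ONE set letter, carried not discharged (dealer R-S1-48 (c) ∕ R-S1-53): `hC : C = 𝒪⁺ ∖ B⁺_2` («`σ`-fixed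
elements have EVEN `w`-order at a ramified place», so `C = B⁺_0 ∖ B⁺_1 = B⁺_0 ∖ B⁺_2`).

Print: [WeilBNT1967] Ch. II §5 Prop. 3 Cor. 2 (orthogonality of characters of compact groups; for an additive character `ψ` of conductor `𝔭^a` and the unit shell
`𝒪^× = 𝒪 ∖ 𝔭`: `∫_{𝒪^×} ψ = vol(𝒪^×)`, `−vol(𝔭)`, `0` according as `a = 0`, `a = 1`, `a ≥ 2` — the three values behind `|G(χ, ψ)|² = q^{a(χ)}`); [Serre1979] Ch. XIV §6;
[IrelandRosen1990] Ch. 8 §2 (the finite-field shadow `Σ_{t ≠ 0} ζ^{t} = −1`).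

## WHAT THIS FILE PROVES (hypothesis-first, place-parity-free)
* §0 `measurableSet_intBall` (`𝒪⁺`, = ★ `measurableSet_ball` at `j = 0` after `pow_zero`), `mem_intBall_add_iff` (ultrametric), `varpi_sq_le_one` (`B⁺_2 ⊆ 𝒪⁺`).
* §1 `setIntegral_eq_zero_of_addCharOn_witness` — THE ENGINE: for a measurable `S ⊆ 𝒪⁺` stable under translation by some `c₁ ∈ 𝒪⁺` with `ψ c₁ ≠ 1`: `∫_S ψ dν = 0`
  (translation is a `ν`-preserving homeomorphism of `R⁺` — Mathlib `measurePreserving_add_left`, ★-pattern `MeasurePreserving.setIntegral_preimage_emb` — and `ψ(c₁ + c) = ψ c₁ · ψ c`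
  ON `S`; no integrability needed); `setIntegral_intBall_eq_zero_of_addCharOn_witness` (`S = 𝒪⁺`).
* §2 THE THREE VALUES on `C` (letter `hC`):
  (e2) **`setIntegral_fixedUnits_eq_zero_of_addCharOn_witness_two`** — a witness `c₁ ∈ B⁺_2` with `ψ c₁ ≠ 1` (conductor `> 2`) ⇒ `∫_C ψ = 0` (§1 at `S = 𝒪⁺ ∖ B⁺_2`, stable under
  `B⁺_2`-translations; NO integrability);
  (e1) **`setIntegral_fixedUnits_eq_neg_measureReal_of_addCharOn`** — `ψ = 1` on `B⁺_2`, a witness `c₁ ∈ 𝒪⁺` with `ψ c₁ ≠ 1`, and `ψ` INTEGRABLE on `𝒪⁺` (load-bearing: the shell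
  split is junk-sensitive) ⇒ `∫_C ψ = −ν.real(B⁺_2)` (Mathlib `setIntegral_sdiff` + §1 on `𝒪⁺` + `setIntegral_const` on `B⁺_2`);
  (e0) **`setIntegral_fixedUnits_eq_measureReal_of_eq_one`** — `ψ = 1` on `𝒪⁺` ⇒ `∫_C ψ = ν.real(C)` (no letter needed: `C ⊆ 𝒪⁺`, ★ `measurableSet_fixedUnits`).
HONEST LABEL: infrastructure for P-WILD-1's `hI₀ hI₁ hI₂` (which additionally need P-WILD-1's chart: additivity of `c ↦ Ē(1 + u(1+e)c)` on `𝒪⁺` and its conductor in terms of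
`ord(1+e)`, and the letter `hC` ∕ `𝔪⁺ = B⁺_2`); pays NO socket ((S-W) of U4Keys :182 OPEN); HC_CM is proved only modulo the 7 printed citations (2 remaining named inputs:
hLiu418 = `stmt-HodgeConjecture-24832`, h413 = `stmt-HodgeConjecture-24833`) until rung 0 closes; REL ≠ ★ ≠ BUILT; count-neutral.

## References
* [WeilBNT1967] A. Weil, *Basic Number Theory*, Grundlehren 144, Springer (1967), Ch. I §2; Ch. II §5 (Prop. 3, Cor. 2).
* [Serre1979] J.-P. Serre, *Local Fields*, GTM 67, Springer (1979), Ch. XIV §6.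
* [IrelandRosen1990] K. Ireland, M. Rosen, *A Classical Introduction to Modern Number Theory*, 2nd ed., GTM 84 (1990), Ch. 8 §2.
-/

set_option autoImplicit false
set_option linter.dupNamespace false

noncomputable section

open NumberField IsDedekindDomain MeasureTheory Measure Topology Set
open scoped NNReal ENNReal
open Literature.NumberTheory Literature.NumberTheory.Automorphic Literature.NumberTheory.Automorphic.UnitaryGroup
open Summit.HodgeConjecture.HodgeConjecture.R90.S1.BposRamFixedUnitsHaar
open Summit.HodgeConjecture.HodgeConjecture.R90.S1.WildAdditiveBallOrthogonality

namespace Summit.HodgeConjecture.HodgeConjecture.R90.S1.WildInnerAdditiveSums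

variable (L : Type) [Field L] [NumberField L] [IsCMField L] (v : HeightOneSpectrum (𝓞 ↥(maximalRealSubfield L))) (w : PlacesOver L v)

/-! ## §0 The fixed integers `𝒪⁺ = {c ∈ R⁺ : |c_w| ≤ 1}` (= `B⁺_0`) and the ball `B⁺_2` -/

/-- **`𝒪⁺` is measurable** (★ `measurableSet_ball` at `j = 0`, `|ϖ|^0 = 1`). [cite: WeilBNT1967, Ch. I §2] -/
theorem measurableSet_intBall [MeasurableSpace (LocalRing L v)] [BorelSpace (LocalRing L v)] {ϖ : w.1.adicCompletion L} (hϖ : Valued.v ϖ = WithZero.exp (-1 : ℤ)) :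
    MeasurableSet {c : ↥(HeisRing.fixedPart (conjLocal L (IsCMField.complexConj L) v)) | Valued.v ((c : LocalRing L v) w) ≤ 1} := by
  simpa only [pow_zero] using measurableSet_ball L v w hϖ 0

/-- **`𝒪⁺` is an additive subgroup**: for `c₁ ∈ 𝒪⁺`, `c₁ + c ∈ 𝒪⁺ ↔ c ∈ 𝒪⁺` (ultrametric inequality; ★ `mem_ball_add_iff` at radius `1`). [cite: WeilBNT1967, Ch. I §2] -/
theorem mem_intBall_add_iff {c₁ : ↥(HeisRing.fixedPart (conjLocal L (IsCMField.complexConj L) v))}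
    (hc₁ : Valued.v ((c₁ : LocalRing L v) w) ≤ 1) (c : ↥(HeisRing.fixedPart (conjLocal L (IsCMField.complexConj L) v))) :
    Valued.v (((c₁ + c : ↥(HeisRing.fixedPart (conjLocal L (IsCMField.complexConj L) v))) : LocalRing L v) w) ≤ 1 ↔ Valued.v ((c : LocalRing L v) w) ≤ 1 := by
  have hadd : (((c₁ + c : ↥(HeisRing.fixedPart (conjLocal L (IsCMField.complexConj L) v))) : LocalRing L v) w) = (c₁ : LocalRing L v) w + (c : LocalRing L v) w := by
    rw [AddSubgroup.coe_add, Pi.add_apply]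
  rw [hadd]
  refine ⟨fun h => ?_, fun h => (Valuation.map_add _ _ _).trans (max_le hc₁ h)⟩
  have e : (c : LocalRing L v) w = ((c₁ : LocalRing L v) w + (c : LocalRing L v) w) - (c₁ : LocalRing L v) w := by ring
  rw [e]
  exact (Valuation.map_sub _ _ _).trans (max_le h hc₁)

omit [IsCMField L] in
/-- `|ϖ|^2 ≤ 1`, so **`B⁺_2 ⊆ 𝒪⁺`**. [cite: WeilBNT1967, Ch. I §2] -/
theorem varpi_sq_le_one {ϖ : w.1.adicCompletion L} (hϖ : Valued.v ϖ = WithZero.exp (-1 : ℤ)) : Valued.v ϖ ^ 2 ≤ 1 :=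
  varpi_pow_le_one L v w hϖ 2

/-! ## §1 THE ENGINE: a translation-stable measurable `S ⊆ 𝒪⁺` carrying a witness `ψ c₁ ≠ 1` has `∫_S ψ = 0` -/

section Haar

variable [MeasurableSpace (LocalRing L v)] [BorelSpace (LocalRing L v)]
  (ν : Measure ↥(HeisRing.fixedPart (conjLocal L (IsCMField.complexConj L) v))) [ν.IsAddLeftInvariant]

/-- **ORTHOGONALITY ENGINE.**  `ψ : R⁺ → ℂ` multiplicative on sums INSIDE `𝒪⁺`; `S ⊆ 𝒪⁺` measurable and stable under the translation by some `c₁ ∈ 𝒪⁺` with `ψ c₁ ≠ 1`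
(`(c₁ + ·)⁻¹ S = S`): then `∫_S ψ dν = 0` for every left-invariant `ν` — `∫_S ψ = ∫_S ψ(c₁ + c) dν(c)` (Mathlib `measurePreserving_add_left`, `Homeomorph.addLeft`,
★-pattern `MeasurePreserving.setIntegral_preimage_emb`) `= ψ(c₁) · ∫_S ψ` (additivity ON `S ⊆ 𝒪⁺`, `setIntegral_congr_fun`), and `ψ c₁ ≠ 1`.  No integrability hypothesis.
[cite: WeilBNT1967, Ch. II §5 Prop. 3 Cor. 2] -/
theorem setIntegral_eq_zero_of_addCharOn_witness (ψ : ↥(HeisRing.fixedPart (conjLocal L (IsCMField.complexConj L) v)) → ℂ)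
    (hψadd : ∀ a b : ↥(HeisRing.fixedPart (conjLocal L (IsCMField.complexConj L) v)),
      Valued.v ((a : LocalRing L v) w) ≤ 1 → Valued.v ((b : LocalRing L v) w) ≤ 1 → ψ (a + b) = ψ a * ψ b)
    {S : Set ↥(HeisRing.fixedPart (conjLocal L (IsCMField.complexConj L) v))} (hS : MeasurableSet S)
    (hSO : S ⊆ {c : ↥(HeisRing.fixedPart (conjLocal L (IsCMField.complexConj L) v)) | Valued.v ((c : LocalRing L v) w) ≤ 1})
    {c₁ : ↥(HeisRing.fixedPart (conjLocal L (IsCMField.complexConj L) v))} (hc₁ : Valued.v ((c₁ : LocalRing L v) w) ≤ 1)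
    (hpre : (fun c : ↥(HeisRing.fixedPart (conjLocal L (IsCMField.complexConj L) v)) => c₁ + c) ⁻¹' S = S) (hne : ψ c₁ ≠ 1) :
    ∫ c in S, ψ c ∂ν = 0 := by
  have key := (measurePreserving_add_left ν c₁).setIntegral_preimage_emb (Homeomorph.addLeft c₁).measurableEmbedding ψ S
  rw [hpre] at key
  -- `key : ∫_S ψ (c₁ + c) = ∫_S ψ c`; on `S ⊆ 𝒪⁺` the integrand on the left is `ψ c₁ * ψ c`
  have key2 : ∫ c in S, ψ c₁ * ψ c ∂ν = ∫ c in S, ψ c ∂ν :=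
    (setIntegral_congr_fun hS fun c hc => (hψadd c₁ c hc₁ (hSO hc)).symm).trans key
  rw [integral_const_mul] at key2
  have h : (ψ c₁ - 1) * ∫ c in S, ψ c ∂ν = 0 := by rw [sub_mul, one_mul, key2, sub_self]
  exact (mul_eq_zero.1 h).resolve_left (sub_ne_zero.2 hne)

/-- **`∫_{𝒪⁺} ψ = 0`** for `ψ` additive on `𝒪⁺` with a witness `c₁ ∈ 𝒪⁺`, `ψ c₁ ≠ 1` (§1 at `S = 𝒪⁺`, stable by the ultrametric inequality). [cite: WeilBNT1967, Ch. II §5 Prop. 3 Cor. 2] -/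
theorem setIntegral_intBall_eq_zero_of_addCharOn_witness {ϖ : w.1.adicCompletion L} (hϖ : Valued.v ϖ = WithZero.exp (-1 : ℤ))
    (ψ : ↥(HeisRing.fixedPart (conjLocal L (IsCMField.complexConj L) v)) → ℂ)
    (hψadd : ∀ a b : ↥(HeisRing.fixedPart (conjLocal L (IsCMField.complexConj L) v)),
      Valued.v ((a : LocalRing L v) w) ≤ 1 → Valued.v ((b : LocalRing L v) w) ≤ 1 → ψ (a + b) = ψ a * ψ b)
    {c₁ : ↥(HeisRing.fixedPart (conjLocal L (IsCMField.complexConj L) v))} (hc₁ : Valued.v ((c₁ : LocalRing L v) w) ≤ 1) (hne : ψ c₁ ≠ 1) :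
    ∫ c in {c : ↥(HeisRing.fixedPart (conjLocal L (IsCMField.complexConj L) v)) | Valued.v ((c : LocalRing L v) w) ≤ 1}, ψ c ∂ν = 0 := by
  refine setIntegral_eq_zero_of_addCharOn_witness L v w ν ψ hψadd (measurableSet_intBall L v w hϖ) subset_rfl hc₁ ?_ hne
  ext c
  rw [Set.mem_preimage, Set.mem_setOf_eq, Set.mem_setOf_eq]
  exact mem_intBall_add_iff L v w hc₁ c

/-! ## §2 THE THREE VALUES of `∫_C ψ dν` on the fixed units `C = {|c_w| = 1}` (letter `hC : C = 𝒪⁺ ∖ B⁺_2`) -/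

/-- **(e2) conductor `> 2`: `∫_C ψ dν = 0`** — if `ψ` (additive on `𝒪⁺`) is NOT trivial on `B⁺_2` (witness `c₁ ∈ B⁺_2`, `ψ c₁ ≠ 1`), then under the letter `C = 𝒪⁺ ∖ B⁺_2` the
integral over the fixed units vanishes: translation by `c₁` preserves `𝒪⁺` and `B⁺_2` (ultrametric), hence `C`, and §1 applies.  NO integrability hypothesis.  (The value
`I(e) = 0` of P-WILD-1's `hI₂`.) [cite: WeilBNT1967, Ch. II §5 Prop. 3 Cor. 2] [cite: Serre1979, Ch. XIV §6] -/
theorem setIntegral_fixedUnits_eq_zero_of_addCharOn_witness_two {ϖ : w.1.adicCompletion L} (hϖ : Valued.v ϖ = WithZero.exp (-1 : ℤ))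
    (ψ : ↥(HeisRing.fixedPart (conjLocal L (IsCMField.complexConj L) v)) → ℂ)
    (hψadd : ∀ a b : ↥(HeisRing.fixedPart (conjLocal L (IsCMField.complexConj L) v)),
      Valued.v ((a : LocalRing L v) w) ≤ 1 → Valued.v ((b : LocalRing L v) w) ≤ 1 → ψ (a + b) = ψ a * ψ b)
    (hC : {c : ↥(HeisRing.fixedPart (conjLocal L (IsCMField.complexConj L) v)) | Valued.v ((c : LocalRing L v) w) = 1} =
      {c : ↥(HeisRing.fixedPart (conjLocal L (IsCMField.complexConj L) v)) | Valued.v ((c : LocalRing L v) w) ≤ 1} \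
        {c : ↥(HeisRing.fixedPart (conjLocal L (IsCMField.complexConj L) v)) | Valued.v ((c : LocalRing L v) w) ≤ Valued.v ϖ ^ 2})
    {c₁ : ↥(HeisRing.fixedPart (conjLocal L (IsCMField.complexConj L) v))} (hc₁ : Valued.v ((c₁ : LocalRing L v) w) ≤ Valued.v ϖ ^ 2) (hne : ψ c₁ ≠ 1) :
    ∫ c in {c : ↥(HeisRing.fixedPart (conjLocal L (IsCMField.complexConj L) v)) | Valued.v ((c : LocalRing L v) w) = 1}, ψ c ∂ν = 0 := by
  have hc₁O : Valued.v ((c₁ : LocalRing L v) w) ≤ 1 := hc₁.trans (varpi_sq_le_one L v w hϖ)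
  rw [hC]
  refine setIntegral_eq_zero_of_addCharOn_witness L v w ν ψ hψadd ((measurableSet_intBall L v w hϖ).diff (measurableSet_ball L v w hϖ 2))
    Set.sdiff_subset hc₁O ?_ hne
  ext c
  rw [Set.preimage_sdiff, Set.mem_sdiff, Set.mem_sdiff, Set.mem_preimage, Set.mem_preimage, Set.mem_setOf_eq, Set.mem_setOf_eq, Set.mem_setOf_eq, Set.mem_setOf_eq,
    mem_intBall_add_iff L v w hc₁O c, mem_ball_add_iff L v w 2 hc₁ c]

omit [ν.IsAddLeftInvariant] in
/-- `∫_{B⁺_2} ψ = ν.real(B⁺_2)` when `ψ = 1` on `B⁺_2`. [cite: WeilBNT1967, Ch. II §5] -/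
theorem setIntegral_ball_two_eq_measureReal_of_eq_one {ϖ : w.1.adicCompletion L} (hϖ : Valued.v ϖ = WithZero.exp (-1 : ℤ))
    (ψ : ↥(HeisRing.fixedPart (conjLocal L (IsCMField.complexConj L) v)) → ℂ)
    (hψ2 : ∀ c : ↥(HeisRing.fixedPart (conjLocal L (IsCMField.complexConj L) v)), Valued.v ((c : LocalRing L v) w) ≤ Valued.v ϖ ^ 2 → ψ c = 1) :
    ∫ c in {c : ↥(HeisRing.fixedPart (conjLocal L (IsCMField.complexConj L) v)) | Valued.v ((c : LocalRing L v) w) ≤ Valued.v ϖ ^ 2}, ψ c ∂ν =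
      ((ν.real {c : ↥(HeisRing.fixedPart (conjLocal L (IsCMField.complexConj L) v)) | Valued.v ((c : LocalRing L v) w) ≤ Valued.v ϖ ^ 2} : ℝ) : ℂ) := by
  rw [setIntegral_congr_fun (measurableSet_ball L v w hϖ 2) (fun c hc => hψ2 c hc), setIntegral_const, Complex.real_smul, mul_one]

/-- **(e1) conductor in `(0, 2]`: `∫_C ψ dν = −ν.real(B⁺_2)`** — if `ψ` (additive on `𝒪⁺`, INTEGRABLE on `𝒪⁺`) is trivial on `B⁺_2` but not on `𝒪⁺` (witness `c₁ ∈ 𝒪⁺`, `ψ c₁ ≠ 1`),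
then under the letter `C = 𝒪⁺ ∖ B⁺_2`: `∫_C ψ = ∫_{𝒪⁺} ψ − ∫_{B⁺_2} ψ = 0 − ν.real(B⁺_2)` (Mathlib `setIntegral_sdiff` — integrability is LOAD-BEARING here —, §1 on `𝒪⁺`, and `ψ = 1` on
`B⁺_2`).  (The value `I(e) = −ν(𝔪⁺)` of P-WILD-1's `hI₁`, with `𝔪⁺ = B⁺_2` on the fixed part at a ramified place.) [cite: WeilBNT1967, Ch. II §5 Prop. 3 Cor. 2]
[cite: IrelandRosen1990, Ch. 8 §2] -/
theorem setIntegral_fixedUnits_eq_neg_measureReal_of_addCharOn {ϖ : w.1.adicCompletion L} (hϖ : Valued.v ϖ = WithZero.exp (-1 : ℤ))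
    (ψ : ↥(HeisRing.fixedPart (conjLocal L (IsCMField.complexConj L) v)) → ℂ)
    (hψadd : ∀ a b : ↥(HeisRing.fixedPart (conjLocal L (IsCMField.complexConj L) v)),
      Valued.v ((a : LocalRing L v) w) ≤ 1 → Valued.v ((b : LocalRing L v) w) ≤ 1 → ψ (a + b) = ψ a * ψ b)
    (hint : IntegrableOn ψ {c : ↥(HeisRing.fixedPart (conjLocal L (IsCMField.complexConj L) v)) | Valued.v ((c : LocalRing L v) w) ≤ 1} ν)
    (hC : {c : ↥(HeisRing.fixedPart (conjLocal L (IsCMField.complexConj L) v)) | Valued.v ((c : LocalRing L v) w) = 1} =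
      {c : ↥(HeisRing.fixedPart (conjLocal L (IsCMField.complexConj L) v)) | Valued.v ((c : LocalRing L v) w) ≤ 1} \
        {c : ↥(HeisRing.fixedPart (conjLocal L (IsCMField.complexConj L) v)) | Valued.v ((c : LocalRing L v) w) ≤ Valued.v ϖ ^ 2})
    (hψ2 : ∀ c : ↥(HeisRing.fixedPart (conjLocal L (IsCMField.complexConj L) v)), Valued.v ((c : LocalRing L v) w) ≤ Valued.v ϖ ^ 2 → ψ c = 1)
    {c₁ : ↥(HeisRing.fixedPart (conjLocal L (IsCMField.complexConj L) v))} (hc₁ : Valued.v ((c₁ : LocalRing L v) w) ≤ 1) (hne : ψ c₁ ≠ 1) :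
    ∫ c in {c : ↥(HeisRing.fixedPart (conjLocal L (IsCMField.complexConj L) v)) | Valued.v ((c : LocalRing L v) w) = 1}, ψ c ∂ν =
      -((ν.real {c : ↥(HeisRing.fixedPart (conjLocal L (IsCMField.complexConj L) v)) | Valued.v ((c : LocalRing L v) w) ≤ Valued.v ϖ ^ 2} : ℝ) : ℂ) := by
  have hsub : {c : ↥(HeisRing.fixedPart (conjLocal L (IsCMField.complexConj L) v)) | Valued.v ((c : LocalRing L v) w) ≤ Valued.v ϖ ^ 2} ⊆
      {c : ↥(HeisRing.fixedPart (conjLocal L (IsCMField.complexConj L) v)) | Valued.v ((c : LocalRing L v) w) ≤ 1} :=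
    fun c hc => le_trans (b := Valued.v ϖ ^ 2) hc (varpi_sq_le_one L v w hϖ)
  rw [hC, setIntegral_sdiff (measurableSet_ball L v w hϖ 2) hint hsub, setIntegral_intBall_eq_zero_of_addCharOn_witness L v w ν hϖ ψ hψadd hc₁ hne,
    setIntegral_ball_two_eq_measureReal_of_eq_one L v w ν hϖ ψ hψ2, zero_sub]

omit [ν.IsAddLeftInvariant] in
/-- **(e0) conductor `≤ 0`: `∫_C ψ dν = ν.real(C)`** — if `ψ = 1` on `𝒪⁺` then, `C ⊆ 𝒪⁺` being measurable (★ `measurableSet_fixedUnits`), `∫_C ψ = ∫_C 1 = ν.real(C)`.  (The value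
`I(e) = ν(C)` of P-WILD-1's `hI₀`; no letter needed.) [cite: WeilBNT1967, Ch. II §5] -/
theorem setIntegral_fixedUnits_eq_measureReal_of_eq_one (ψ : ↥(HeisRing.fixedPart (conjLocal L (IsCMField.complexConj L) v)) → ℂ)
    (hψ0 : ∀ c : ↥(HeisRing.fixedPart (conjLocal L (IsCMField.complexConj L) v)), Valued.v ((c : LocalRing L v) w) ≤ 1 → ψ c = 1) :
    ∫ c in {c : ↥(HeisRing.fixedPart (conjLocal L (IsCMField.complexConj L) v)) | Valued.v ((c : LocalRing L v) w) = 1}, ψ c ∂ν =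
      ((ν.real {c : ↥(HeisRing.fixedPart (conjLocal L (IsCMField.complexConj L) v)) | Valued.v ((c : LocalRing L v) w) = 1} : ℝ) : ℂ) := by
  rw [setIntegral_congr_fun (measurableSet_fixedUnits L v w).1 (fun c hc => hψ0 c (le_of_eq hc)), setIntegral_const, Complex.real_smul, mul_one]

end Haar

end Summit.HodgeConjecture.HodgeConjecture.R90.S1.WildInnerAdditiveSums

end
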